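import Mathlib.LinearAlgebra.FreeModule.Finite.Matrix
import Mathlib.LinearAlgebra.FiniteDimensional.Lemmas
import Mathlib.LinearAlgebra.BilinearMap
import HarnessLib

/-!
# Three commuting standard `𝔰𝔩₂`-triples on an `8`-dimensional space: the product basis `W ≅ 2 ⊠ 2 ⊠ 2`
# and the Gram matrix `ω = c · (ε ⊠ ε ⊠ ε)` of every invariant bilinear form

Topic `Literature/RepresentationTheory/GeneralLinear` (namespace `Literature.RepresentationTheory.GeneralLinear.SL2Triple`,
continuing `SL2TripleCommutant` / `SL2TriplePairCommutant`: `𝔰𝔩₂`-triples of operators in isotypic = standard position).  Pure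
linear algebra over a field of characteristic zero; THEOREMS ONLY (no definition, no named fact; D-0026), no Hodge theory imported.
Written for the cell `pub-hodge-ring2` (literature lane gen 73, programme R50 «`B•(X) = D•(X)` for the `End⁰ = ℚ` fourfolds in the
Mumford position»; honest framing of that cell: research route conditional on HC_CM; not a corollary; Q11.4-sentence-2 already refuted
in dim ≥ 3 — this file is unconditional), where it is applied to `W = H¹(X, ℂ)` carrying the three commuting standard triples of
`Motives/HodgeLieWeightOneRankEightMumfordNormalForm` («`Hg(X)` a `ℚ`-form of `SL₂ × SL₂ × SL₂`», `V_ℂ = 2 ⊠ 2 ⊠ 2`; Moonen–Zarhin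
(2.5)(1), Mumford §4).

SETTING.  `(H_i, E_i, F_i)`, `i : Fin 3`, operators on `W` in STANDARD FORM (`H_i² = 1`, `E_i² = F_i² = 0`, `E_iF_i = ½(1 + H_i)`,
`F_iE_i = ½(1 − H_i)`, `H_iE_i = E_i = −E_iH_i`, `H_iF_i = −F_i = −F_iH_i` — i.e. `W` is an isotypic sum of standard representations of
each triple, Fulton–Harris §11.1), any two operators from different triples commuting, `dim W = 8`.

* **`exists_cubeBasis`** — there is a basis `b_x`, `x : Fin 3 → Fin 2`, of `W` of joint weight vectors on which the triples act as on
  `std ⊗ std ⊗ std`: `H_i b_x = ± b_x` (sign `+` iff `x i = 0`), `E_i b_x = b_{x[i ↦ 0]}` if `x i = 1` and `0` otherwise,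
  `F_i b_x = b_{x[i ↦ 1]}` if `x i = 0` and `0` otherwise; AND for every bilinear form `ω` for which the nine operators are skew
  (`ω(Tu, v) = −ω(u, Tv)`), `ω(b_x, b_y) = ω(b_0, b_1) · ∏_i ε(x_i, y_i)` with `ε(0,1) = 1`, `ε(1,0) = −1`, `ε(a,a) = 0` — the Gram
  matrix is a multiple of the Kronecker cube of the `2 × 2` symplectic form.  PROOF: a common fixed vector `u₀ ≠ 0` of the projectors
  `P_i = E_iF_i` (from any `v ≠ 0`, replacing `v` by `P_i v` or, if that vanishes, by `E_i v`, as `v = F_iE_iv`); `b_x = (∏_{x_i = 1} F_i) u₀`;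
  the `b_x` are non-zero joint eigenvectors with pairwise distinct sign patterns, hence `8 = dim W` independent vectors; the Gram
  matrix by moving the `F_i` across `ω` (`ω(u, u') = 0` for two eigenvectors of the same eigenvalue of a skew involution `H_i`).

## References

* [FultonHarris1991] W. Fulton, J. Harris, *Representation Theory*, GTM 129 (1991), Lecture 11 (§11.1), §13.1 (weights of tensor
  products).
* [Humphreys1972] J. E. Humphreys, GTM 9 (1972), §7.2 (the modules `V(m)`; `V(1)` = standard).
* [MoonenZarhin1999LowDim] B. Moonen, Yu. Zarhin, Math. Ann. 315 (1999), §2 (2.5)(1) (the `SL₂³`-form acting on `2 ⊠ 2 ⊠ 2`).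
* [Mumford1969NoteShimura] D. Mumford, Math. Ann. 181 (1969), §4.
-/

namespace Literature.RepresentationTheory.GeneralLinear

universe u v

variable {K : Type u} [Field K] [CharZero K] {W : Type v} [AddCommGroup W] [Module K W]

namespace SL2Triple

set_option maxHeartbeats 3200000 in
/-- **The product basis `W ≅ 2 ⊠ 2 ⊠ 2` of three commuting standard `𝔰𝔩₂`-triples on an `8`-dimensional space, and the Gram
matrix of an invariant form** (see the module docstring).  Basis vectors are indexed by `x : Fin 3 → Fin 2` (`x i = 0`: weight `+1`
for `H_i`; `x i = 1`: weight `−1`).  [cite: FultonHarris1991, Lecture 11 (§11.1) and §13.1] [cite: Humphreys1972, §7.2]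
[cite: MoonenZarhin1999LowDim, §2 (2.5)(1)] -/
theorem exists_cubeBasis [FiniteDimensional K W] (Hh Ee Ff : Fin 3 → Module.End K W)
    (hstd : ∀ i, Hh i * Hh i = 1 ∧ Ee i * Ee i = 0 ∧ Ff i * Ff i = 0 ∧ Ee i * Ff i = (2 : K)⁻¹ • (1 + Hh i) ∧
      Ff i * Ee i = (2 : K)⁻¹ • (1 - Hh i) ∧ Hh i * Ee i = Ee i ∧ Ee i * Hh i = -Ee i ∧ Hh i * Ff i = -Ff i ∧
      Ff i * Hh i = Ff i)
    (hcomm : ∀ i j, i ≠ j →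
      Hh i * Hh j = Hh j * Hh i ∧ Hh i * Ee j = Ee j * Hh i ∧ Hh i * Ff j = Ff j * Hh i ∧
      Ee i * Hh j = Hh j * Ee i ∧ Ee i * Ee j = Ee j * Ee i ∧ Ee i * Ff j = Ff j * Ee i ∧
      Ff i * Hh j = Hh j * Ff i ∧ Ff i * Ee j = Ee j * Ff i ∧ Ff i * Ff j = Ff j * Ff i)
    (hW : Module.finrank K W = 8) :
    ∃ b : Module.Basis (Fin 3 → Fin 2) K W,
      (∀ i x, Hh i (b x) = (if x i = 0 then (1 : K) else -1) • b x) ∧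
      (∀ i x, x i = 1 → Ee i (b x) = b (Function.update x i 0)) ∧ (∀ i x, x i = 0 → Ee i (b x) = 0) ∧
      (∀ i x, x i = 0 → Ff i (b x) = b (Function.update x i 1)) ∧ (∀ i x, x i = 1 → Ff i (b x) = 0) ∧
      ∀ ω : LinearMap.BilinForm K W,
        (∀ i u v, ω (Hh i u) v = -ω u (Hh i v)) → (∀ i u v, ω (Ee i u) v = -ω u (Ee i v)) →
        (∀ i u v, ω (Ff i u) v = -ω u (Ff i v)) →
        ∀ x y, ω (b x) (b y) = ω (b fun _ => 0) (b fun _ => 1) *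
          ∏ i, (if x i = y i then (0 : K) else if x i = 0 then 1 else -1) := by
  classical
  have h01 : ∀ a : Fin 2, a = 0 ∨ a = 1 := by decide
  have h10 : (1 : Fin 2) ≠ 0 := by decide
  have h012 : ∀ i : Fin 3, i = 0 ∨ i = 1 ∨ i = 2 := by decide
  -- unpack the relations
  have hEE : ∀ i, Ee i * Ee i = 0 := fun i => (hstd i).2.1
  have hFF : ∀ i, Ff i * Ff i = 0 := fun i => (hstd i).2.2.1
  have hEF : ∀ i, Ee i * Ff i = (2 : K)⁻¹ • (1 + Hh i) := fun i => (hstd i).2.2.2.1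
  have hFE : ∀ i, Ff i * Ee i = (2 : K)⁻¹ • (1 - Hh i) := fun i => (hstd i).2.2.2.2.1
  have hHE : ∀ i, Hh i * Ee i = Ee i := fun i => (hstd i).2.2.2.2.2.1
  have hEH : ∀ i, Ee i * Hh i = -Ee i := fun i => (hstd i).2.2.2.2.2.2.1
  have hHF : ∀ i, Hh i * Ff i = -Ff i := fun i => (hstd i).2.2.2.2.2.2.2.1
  have hFH : ∀ i, Ff i * Hh i = Ff i := fun i => (hstd i).2.2.2.2.2.2.2.2
  have hFFc : ∀ i j, Ff i * Ff j = Ff j * Ff i := fun i j => by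
    by_cases h : i = j
    · subst h; rfl
    · exact (hcomm i j h).2.2.2.2.2.2.2.2
  have hHFc : ∀ i j, i ≠ j → Hh i * Ff j = Ff j * Hh i := fun i j h => (hcomm i j h).2.2.1
  have hEFc : ∀ i j, i ≠ j → Ee i * Ff j = Ff j * Ee i := fun i j h => (hcomm i j h).2.2.2.2.2.1
  -- the projectors `P_i = E_i F_i`: `P² = P`, `P E = E`, `E P = 0`, `F P = F`, `P F = 0`, `H P = P`, `1 - P = F E`
  set P : Fin 3 → Module.End K W := fun i => Ee i * Ff i with hPdef
  have hPapply : ∀ i v, P i v = Ee i (Ff i v) := fun i v => rfl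
  have hPE : ∀ i, P i * Ee i = Ee i := fun i => by
    change Ee i * Ff i * Ee i = Ee i
    rw [mul_assoc, hFE, mul_smul_comm, mul_sub, mul_one, hEH, sub_neg_eq_add, ← two_smul K (Ee i), smul_smul,
      inv_mul_cancel₀ (two_ne_zero' K), one_smul]
  have hEP : ∀ i, Ee i * P i = 0 := fun i => by
    change Ee i * (Ee i * Ff i) = 0
    rw [← mul_assoc, hEE, zero_mul]
  have hFP : ∀ i, Ff i * P i = Ff i := fun i => by
    change Ff i * (Ee i * Ff i) = Ff i
    rw [← mul_assoc, hFE, smul_mul_assoc, sub_mul, one_mul, hHF, sub_neg_eq_add, ← two_smul K (Ff i), smul_smul,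
      inv_mul_cancel₀ (two_ne_zero' K), one_smul]
  have hPF : ∀ i, P i * Ff i = 0 := fun i => by
    change Ee i * Ff i * Ff i = 0
    rw [mul_assoc, hFF, mul_zero]
  have hHP : ∀ i, Hh i * P i = P i := fun i => by
    change Hh i * (Ee i * Ff i) = Ee i * Ff i
    rw [← mul_assoc, hHE]
  have h1P : ∀ i, 1 - P i = Ff i * Ee i := fun i => by
    change 1 - Ee i * Ff i = Ff i * Ee i
    rw [hEF, hFE]; module
  have hPP : ∀ i, P i * P i = P i := fun i => by
    change P i * (Ee i * Ff i) = Ee i * Ff i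
    rw [← mul_assoc, hPE]
  -- cross-index commutations of `P_i` with `P_j`, `E_j`, `F_j`, `H_j`
  have hPFc : ∀ i j, i ≠ j → P i * Ff j = Ff j * P i := fun i j h => by
    change Ee i * Ff i * Ff j = Ff j * (Ee i * Ff i)
    rw [mul_assoc, hFFc i j, ← mul_assoc, hEFc i j h, mul_assoc]
  have hPEc : ∀ i j, i ≠ j → P i * Ee j = Ee j * P i := fun i j h => by
    change Ee i * Ff i * Ee j = Ee j * (Ee i * Ff i)
    rw [mul_assoc, ← hEFc j i (Ne.symm h), ← mul_assoc, (hcomm i j h).2.2.2.2.1, mul_assoc]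
  have hPPc : ∀ i j, i ≠ j → P i * P j = P j * P i := fun i j h => by
    change P i * (Ee j * Ff j) = Ee j * Ff j * P i
    rw [← mul_assoc, hPEc i j h, mul_assoc, hPFc i j h, ← mul_assoc]
  -- a common non-zero fixed vector `u₀` of `P₀, P₁, P₂`
  have step : ∀ (i : Fin 3) (v : W), v ≠ 0 → ∃ v' : W, v' ≠ 0 ∧ P i v' = v' ∧ (v' = P i v ∨ v' = Ee i v) := by
    intro i v hv
    by_cases hPv : P i v = 0
    · have hv' : v = Ff i (Ee i v) := by
        have h := congrArg (fun T : Module.End K W => T v) (h1P i)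
        simp only [LinearMap.sub_apply, Module.End.one_apply, Module.End.mul_apply, hPv, sub_zero] at h
        exact h
      refine ⟨Ee i v, fun h0 => hv (by rw [hv', h0, map_zero]), ?_, Or.inr rfl⟩
      rw [← Module.End.mul_apply, hPE]
    · refine ⟨P i v, hPv, ?_, Or.inl rfl⟩
      rw [← Module.End.mul_apply, hPP]
  have carry : ∀ (i j : Fin 3) (v v' : W), i ≠ j → P j v = v → (v' = P i v ∨ v' = Ee i v) → P j v' = v' := by
    rintro i j v v' hij hv (rfl | rfl)
    · rw [← Module.End.mul_apply, ← hPPc i j hij, Module.End.mul_apply, hv]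
    · rw [← Module.End.mul_apply, hPEc j i (Ne.symm hij), Module.End.mul_apply, hv]
  haveI : Nontrivial W := Module.nontrivial_of_finrank_pos (R := K) (by rw [hW]; norm_num)
  obtain ⟨v, hv⟩ := exists_ne (0 : W)
  obtain ⟨v₁, hv₁, hP0v₁, -⟩ := step 0 v hv
  obtain ⟨v₂, hv₂, hP1v₂, hor₂⟩ := step 1 v₁ hv₁
  have hP0v₂ : P 0 v₂ = v₂ := carry 1 0 v₁ v₂ (by decide) hP0v₁ hor₂
  obtain ⟨u₀, hu₀, hP2u₀, hor₃⟩ := step 2 v₂ hv₂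
  have hP0u₀ : P 0 u₀ = u₀ := carry 2 0 v₂ u₀ (by decide) hP0v₂ hor₃
  have hP1u₀ : P 1 u₀ = u₀ := carry 2 1 v₂ u₀ (by decide) hP1v₂ hor₃
  have hPu₀ : ∀ i, P i u₀ = u₀ := fun i => by
    rcases h012 i with rfl | rfl | rfl
    · exact hP0u₀
    · exact hP1u₀
    · exact hP2u₀
  have hHu₀ : ∀ i, Hh i u₀ = u₀ := fun i => by
    conv_lhs => rw [← hPu₀ i]
    rw [← Module.End.mul_apply, hHP, hPu₀]
  have hEu₀ : ∀ i, Ee i u₀ = 0 := fun i => by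
    rw [← hPu₀ i, ← Module.End.mul_apply, hEP, LinearMap.zero_apply]
  -- the family `b_x = (∏_{x_i = 1} F_i) u₀`
  set G : Fin 3 → (Fin 3 → Fin 2) → Module.End K W := fun i x => if x i = 1 then Ff i else 1 with hGdef
  have hG1 : ∀ i x, x i = 1 → G i x = Ff i := fun i x h => by simp only [hGdef, h, if_true]
  have hG0 : ∀ i x, x i = 0 → G i x = 1 := fun i x h => by
    have h' : ¬ x i = 1 := by rw [h]; decide
    simp only [hGdef, h', if_false]
  have hGcomm : ∀ i j x y (w : W), G i x (G j y w) = G j y (G i x w) := by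
    intro i j x y w
    by_cases hi : x i = 1 <;> by_cases hj : y j = 1 <;>
      simp only [hGdef, hi, hj, if_true, if_false, Module.End.one_apply]
    rw [← Module.End.mul_apply, hFFc, Module.End.mul_apply]
  have hGP : ∀ i j x (w : W), i ≠ j → P i (G j x w) = G j x (P i w) := by
    intro i j x w hij
    by_cases hj : x j = 1
    · rw [hG1 j x hj, ← Module.End.mul_apply, hPFc i j hij, Module.End.mul_apply]
    · simp only [hGdef, hj, if_false, Module.End.one_apply]
  have hGupd_ne : ∀ i j x (a : Fin 2), i ≠ j → G j (Function.update x i a) = G j x := by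
    intro i j x a hij
    simp only [hGdef, Function.update_of_ne (Ne.symm hij)]
  set bt : (Fin 3 → Fin 2) → W := fun x => G 0 x (G 1 x (G 2 x u₀)) with hbtdef
  have hbt_apply : ∀ x, bt x = G 0 x (G 1 x (G 2 x u₀)) := fun x => by rw [hbtdef]
  -- `b_x = G_i x (r)` with `P_i r = r`, `r` unchanged when `x i` changes
  have key : ∀ i x, ∃ r : W, P i r = r ∧ ∀ a : Fin 2, bt (Function.update x i a) = G i (Function.update x i a) r := by
    intro i x
    rcases h012 i with rfl | rfl | rfl
    · refine ⟨G 1 x (G 2 x u₀), ?_, fun a => ?_⟩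
      · rw [hGP 0 1 x _ (by decide), hGP 0 2 x _ (by decide), hPu₀]
      · rw [hbt_apply, hGupd_ne 0 1 x a (by decide), hGupd_ne 0 2 x a (by decide)]
    · refine ⟨G 0 x (G 2 x u₀), ?_, fun a => ?_⟩
      · rw [hGP 1 0 x _ (by decide), hGP 1 2 x _ (by decide), hPu₀]
      · rw [hbt_apply, hGupd_ne 1 0 x a (by decide), hGupd_ne 1 2 x a (by decide), hGcomm 0 1]
    · refine ⟨G 0 x (G 1 x u₀), ?_, fun a => ?_⟩
      · rw [hGP 2 0 x _ (by decide), hGP 2 1 x _ (by decide), hPu₀]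
      · rw [hbt_apply, hGupd_ne 2 0 x a (by decide), hGupd_ne 2 1 x a (by decide), hGcomm 1 2, hGcomm 0 2]
  have hupd_self : ∀ (x : Fin 3 → Fin 2) i, Function.update x i (x i) = x := fun x i => Function.update_eq_self i x
  have hbx_of : ∀ i x (r : W), (∀ a : Fin 2, bt (Function.update x i a) = G i (Function.update x i a) r) →
      bt x = G i x r := fun i x r hb => by
    have h := hb (x i)
    rwa [hupd_self] at h
  -- the actions on `b_x`
  have hbE1 : ∀ i x, x i = 1 → Ee i (bt x) = bt (Function.update x i 0) := by
    intro i x hx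
    obtain ⟨r, hr, hb⟩ := key i x
    have hbx : bt x = Ff i r := by rw [hbx_of i x r hb, hG1 i x hx]
    rw [hbx, hb 0, hG0 i _ (by rw [Function.update_self]), Module.End.one_apply, ← hPapply, hr]
  have hbE0 : ∀ i x, x i = 0 → Ee i (bt x) = 0 := by
    intro i x hx
    obtain ⟨r, hr, hb⟩ := key i x
    have hbx : bt x = r := by rw [hbx_of i x r hb, hG0 i x hx, Module.End.one_apply]
    rw [hbx, ← hr, ← Module.End.mul_apply, hEP, LinearMap.zero_apply]
  have hbF0 : ∀ i x, x i = 0 → Ff i (bt x) = bt (Function.update x i 1) := by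
    intro i x hx
    obtain ⟨r, hr, hb⟩ := key i x
    have hbx : bt x = r := by rw [hbx_of i x r hb, hG0 i x hx, Module.End.one_apply]
    rw [hbx, hb 1, hG1 i _ (by rw [Function.update_self])]
  have hbF1 : ∀ i x, x i = 1 → Ff i (bt x) = 0 := by
    intro i x hx
    obtain ⟨r, hr, hb⟩ := key i x
    have hbx : bt x = Ff i r := by rw [hbx_of i x r hb, hG1 i x hx]
    rw [hbx, ← Module.End.mul_apply, hFF, LinearMap.zero_apply]
  have hbH : ∀ i x, Hh i (bt x) = (if x i = 0 then (1 : K) else -1) • bt x := by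
    intro i x
    obtain ⟨r, hr, hb⟩ := key i x
    rcases h01 (x i) with hx | hx
    · have hbx : bt x = r := by rw [hbx_of i x r hb, hG0 i x hx, Module.End.one_apply]
      rw [if_pos hx, one_smul, hbx]
      conv_lhs => rw [← hr]
      rw [← Module.End.mul_apply, hHP, hr]
    · have hbx : bt x = Ff i r := by rw [hbx_of i x r hb, hG1 i x hx]
      rw [hx, if_neg h10, hbx, ← Module.End.mul_apply, hHF, LinearMap.neg_apply, neg_one_smul]
  -- `b_x ≠ 0`
  have hbt0' : ∀ z : Fin 3 → Fin 2, z 0 = 0 → z 1 = 0 → z 2 = 0 → bt z = u₀ := fun z h0 h1 h2 => by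
    rw [hbt_apply, hG0 0 z h0, hG0 1 z h1, hG0 2 z h2, Module.End.one_apply, Module.End.one_apply,
      Module.End.one_apply]
  have hbt0 : bt (fun _ => 0) = u₀ := hbt0' (fun _ => 0) rfl rfl rfl
  have hdown : ∀ i x, bt x = 0 → bt (Function.update x i 0) = 0 := by
    intro i x hx
    rcases h01 (x i) with h | h
    · rw [← h, hupd_self]; exact hx
    · rw [← hbE1 i x h, hx, map_zero]
  have hbt_ne : ∀ x, bt x ≠ 0 := by
    intro x hx
    have h3 := hdown 2 _ (hdown 1 _ (hdown 0 x hx))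
    have hconst : Function.update (Function.update (Function.update x 0 0) 1 0) 2 0 = fun _ => 0 := by
      funext i
      rcases h012 i with rfl | rfl | rfl <;> simp [Function.update_self, Function.update_of_ne]
    rw [hconst, hbt0] at h3
    exact hu₀ h3
  -- the projectors separate the `b_x`: `Π_x b_y = [y = x] b_y`
  have hPb : ∀ i y, P i (bt y) = if y i = 0 then bt y else 0 := by
    intro i y
    have h := congrArg (fun T : Module.End K W => T (bt y)) (hEF i)
    simp only [LinearMap.smul_apply, LinearMap.add_apply, Module.End.one_apply, hbH] at h
    change P i (bt y) = _ at h
    rw [h]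
    rcases h01 (y i) with hy | hy
    · rw [if_pos hy, if_pos hy, one_smul, ← two_smul K (bt y), smul_smul, inv_mul_cancel₀ (two_ne_zero' K), one_smul]
    · rw [hy, if_neg h10, if_neg h10, neg_one_smul, add_neg_cancel, smul_zero]
  set Q : Fin 3 → Fin 2 → Module.End K W := fun i a => if a = 0 then P i else 1 - P i with hQdef
  have hQb : ∀ i a y, Q i a (bt y) = if y i = a then bt y else 0 := by
    intro i a y
    rcases h01 a with ha | ha
    · rw [ha]
      simp only [hQdef, if_true, hPb]
    · rw [ha]
      simp only [hQdef, h10, if_false, LinearMap.sub_apply, Module.End.one_apply, hPb]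
      rcases h01 (y i) with hy | hy
      · rw [hy, if_pos rfl, if_neg h10.symm, sub_self]
      · rw [hy, if_neg h10, if_pos rfl, sub_zero]
  have hQcomm : ∀ i j, i ≠ j → ∀ a c (w : W), Q i a (Q j c w) = Q j c (Q i a w) := by
    intro i j hij a c w
    have hPc : ∀ w : W, P i (P j w) = P j (P i w) := fun w => by
      rw [← Module.End.mul_apply, hPPc i j hij, Module.End.mul_apply]
    rcases h01 a with rfl | rfl <;> rcases h01 c with rfl | rfl <;>
      (simp only [hQdef, if_true, h10, if_false, LinearMap.sub_apply, Module.End.one_apply, map_sub, hPc]; try abel)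
  have hPib : ∀ x y, Q 0 (x 0) (Q 1 (x 1) (Q 2 (x 2) (bt y))) = if y = x then bt y else 0 := by
    intro x y
    by_cases h : y = x
    · subst h
      rw [hQb, if_pos rfl, hQb, if_pos rfl, hQb, if_pos rfl, if_pos rfl]
    · rw [if_neg h]
      have hne : ∃ i, y i ≠ x i := by
        by_contra hall
        push Not at hall
        exact h (funext hall)
      obtain ⟨i, hi⟩ := hne
      rcases h012 i with rfl | rfl | rfl
      · rw [hQcomm 1 2 (by decide), hQcomm 0 2 (by decide), hQcomm 0 1 (by decide), hQb 0, if_neg hi, map_zero,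
          map_zero]
      · rw [hQcomm 1 2 (by decide), hQb 1, if_neg hi, map_zero, map_zero]
      · rw [hQb 2, if_neg hi, map_zero, map_zero]
  have hli : LinearIndependent K bt := by
    rw [linearIndependent_iff']
    intro s g hg x hx
    have h := congrArg (fun w => Q 0 (x 0) (Q 1 (x 1) (Q 2 (x 2) w))) hg
    simp only [map_sum, map_smul, map_zero, hPib] at h
    rw [Finset.sum_eq_single x (fun y _ hyx => by rw [if_neg hyx, smul_zero]) (fun hxs => absurd hx hxs), if_pos rfl] at h
    exact (smul_eq_zero.1 h).resolve_right (hbt_ne x)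
  have hcard : Fintype.card (Fin 3 → Fin 2) = Module.finrank K W := by
    rw [hW, Fintype.card_fun, Fintype.card_fin, Fintype.card_fin]; norm_num
  let b : Module.Basis (Fin 3 → Fin 2) K W := basisOfLinearIndependentOfCardEqFinrank hli hcard
  have hb : ∀ x, b x = bt x := fun x => by
    rw [coe_basisOfLinearIndependentOfCardEqFinrank]
  refine ⟨b, fun i x => by rw [hb]; exact hbH i x, fun i x hx => by rw [hb, hb]; exact hbE1 i x hx,
    fun i x hx => by rw [hb]; exact hbE0 i x hx, fun i x hx => by rw [hb, hb]; exact hbF0 i x hx,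
    fun i x hx => by rw [hb]; exact hbF1 i x hx, ?_⟩
  -- the Gram matrix of an invariant form
  intro ω hωH hωE hωF x y
  simp only [hb]
  by_cases hxy : ∃ i, x i = y i
  · -- a common index with equal sign: both sides vanish
    obtain ⟨i, hi⟩ := hxy
    have hprod : (∏ j, (if x j = y j then (0 : K) else if x j = 0 then 1 else -1)) = 0 :=
      Finset.prod_eq_zero (Finset.mem_univ i) (by rw [if_pos hi])
    rw [hprod, mul_zero]
    have h := hωH i (bt x) (bt y)
    rw [hbH, hbH, ← hi, map_smul, LinearMap.smul_apply, map_smul, smul_eq_mul] at h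
    rcases h01 (x i) with h0 | h1
    · rw [if_pos h0, one_mul] at h
      exact CharZero.eq_neg_self_iff.1 h
    · rw [h1, if_neg h10, neg_one_mul, neg_neg] at h
      exact CharZero.eq_neg_self_iff.1 h.symm
  · push Not at hxy
    -- complementary sign patterns: move the three `G_i x` across `ω`
    set s : Fin 3 → (Fin 3 → Fin 2) → K := fun i z => if z i = 1 then -1 else 1 with hsdef
    have hωG : ∀ i z (u w : W), ω (G i z u) w = s i z * ω u (G i z w) := by
      intro i z u w
      by_cases hz : z i = 1
      · simp only [hGdef, hsdef, hz, if_true, hωF, neg_one_mul]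
      · simp only [hGdef, hsdef, hz, if_false, Module.End.one_apply, one_mul]
    have hGFc : ∀ i j z (w : W), G i z (Ff j w) = Ff j (G i z w) := by
      intro i j z w
      by_cases hz : z i = 1
      · rw [hG1 i z hz, ← Module.End.mul_apply, hFFc i j, Module.End.mul_apply]
      · simp only [hGdef, hz, if_false, Module.End.one_apply]
    -- `ω(b_x', b_y') = s₀ s₁ s₂ · ω(u₀, F₀ F₁ F₂ u₀)` for complementary `x', y'`
    have hmain : ∀ x' y' : Fin 3 → Fin 2, (∀ i, x' i ≠ y' i) →
        ω (bt x') (bt y') = s 0 x' * (s 1 x' * (s 2 x' * ω u₀ (Ff 0 (Ff 1 (Ff 2 u₀))))) := by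
      intro x' y' hxy'
      have hGG' : ∀ i (w : W), G i x' (G i y' w) = Ff i w := by
        intro i w
        rcases h01 (x' i) with hx | hx
        · have hy : y' i = 1 := (h01 (y' i)).resolve_left (fun h => hxy' i (hx.trans h.symm))
          rw [hG0 i x' hx, hG1 i y' hy, Module.End.one_apply]
        · have hy : y' i = 0 := (h01 (y' i)).resolve_right (fun h => hxy' i (hx.trans h.symm))
          rw [hG1 i x' hx, hG0 i y' hy, Module.End.one_apply]
      have hN : G 2 x' (G 1 x' (G 0 x' (G 0 y' (G 1 y' (G 2 y' u₀))))) = Ff 0 (Ff 1 (Ff 2 u₀)) := by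
        rw [hGG' 0, hGFc 1 0, hGG' 1, hGFc 2 0, hGFc 2 1, hGG' 2]
      change ω (G 0 x' (G 1 x' (G 2 x' u₀))) (G 0 y' (G 1 y' (G 2 y' u₀))) = _
      rw [hωG 0, hωG 1, hωG 2, hN]
    have hs0 : ∀ i, s i (fun _ => (0 : Fin 2)) = 1 := fun i => by
      simp only [hsdef, Fin.zero_eq_one_iff, OfNat.ofNat_ne_one, if_false]
    rw [hmain x y hxy, hmain (fun _ => 0) (fun _ => 1) (fun i => by decide)]
    simp only [hs0, one_mul]
    have hε : ∀ i, (if x i = y i then (0 : K) else if x i = 0 then 1 else -1) = s i x := fun i => by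
      rw [if_neg (hxy i)]
      rcases h01 (x i) with h | h
      · simp only [h, if_true, hsdef, Fin.zero_eq_one_iff, OfNat.ofNat_ne_one, if_false]
      · simp only [h, h10, if_false, hsdef, if_true]
    rw [Fin.prod_univ_three, hε 0, hε 1, hε 2]
    ring

end SL2Triple

end Literature.RepresentationTheory.GeneralLinear
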